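/-
Copyright (c) 2026 the pub-hodgecm-mathlib formalisation cell (harness21).  Prover seat hodgecm-mathlib-K2E5-p16 (g6), Track B «K2-LIT»,
#184♮ = hLiu418 = `stmt-HodgeConjecture-24832`; organ S2-J, (J2⊗-arch) FILE 2b part 1 `K2LiuArchTensorEmbArchComponent` (LEAD F0P6-plan (g14)
BATCH #20 (1)): the archimedean COMPONENT MATRICES of the tensor embedding `k ↦ k ⊗ 1` — `(k ⊗ 1)_∞ = reindex epsD (k_∞ ⊗ₖ 1)` over `E ⊗ ℝ` and, at
each complex place `w`, `((k ⊗ 1)_∞)_w = reindex epsD ((k_∞)_w ⊗ₖ 1)`.  THEOREMS ONLY (no `def`, no `instance`, no notation, no `sorry`).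
-/
import Summits.HodgeConjecture.HodgeConjecture.Theorems.K2LiuTensorEmbArchFinParts   -- ★ `map_coe_tensorEmb`, `kronecker_one_map`, arch∕fin parts
import HarnessLib

/-!
# Crux `HLiu418`, organ S2-J, (J2⊗-arch) FILE 2b part 1: archimedean component matrices of `k ↦ k ⊗ 1`

Cell `hodgecm-mathlib`, crux item hLiu418 = `stmt-HodgeConjecture-24832` (helper lane `--supports`, count-neutral).

* `coe_archPart_apply` — entries of `g_∞` are `ringEquiv_mixedSpace (fst g_{ij})` (definitional);
* **`coe_archPart_tensorEmb`** — `(k ⊗ 1)_∞ = reindex epsD (k_∞ ⊗ₖ 1)` as matrices over `mixedSpace L` (★ `K2LiuTensorEmbPlaceComponents.map_coe_tensorEmb`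
  with `f = ringEquiv_mixedSpace ∘ adeleFst`);
* **`coe_archAt_archPart_tensorEmb`** — `((k ⊗ 1)_∞)_w = reindex epsD ((k_∞)_w ⊗ₖ 1)` as complex matrices at every complex place `w` (★ `coe_archAt`).
With ★ `placeSec_apply` ∕ ★ `archAt_archSingle_self∕_of_ne` (the 𝔻 side) this gives the `w`-components of `(placeSec_𝔻 σ h) ⊗ 1`: `1` off `wOf σ`,
`reindex epsD ((toUFormEquiv_𝔻⁻¹ h) ⊗ₖ 1)` at `wOf σ` — part 2 compares the latter with `placeSec_𝕎 σ (relabel E (toBig (h,1)))` through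
★ FILE 2a `reindex_signSplit_scaleConj_tensor` and ★ `coe_toUForm`∕`coe_toBig`∕`UForm.coe_relabel`.
References: [BorelJacquet1979, §4.1]; [Kudla1994, §2]; [HarrisKudlaSweet1996, §1 (1.8)].
HONEST LABEL: HC_CM is proved only modulo the 7 printed citations (2 remaining named inputs: hLiu418 = stmt-HodgeConjecture-24832,
h413 = stmt-HodgeConjecture-24833) until rung 0 closes; count-neutral helper, closes no socket.
-/

set_option autoImplicit false
set_option linter.dupNamespace false

noncomputable section

open scoped Matrix Kronecker Classical
open NumberField NumberField.mixedEmbedding IsDedekindDomain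

namespace Summit.HodgeConjecture.HodgeConjecture.Cruxes.HLiu418.K2LiuArchTensorEmbArchComponent

open Literature.NumberTheory.Automorphic Literature.NumberTheory.Automorphic.UnitaryGroup
open Literature.NumberTheory.GelbartRogawski1991 Literature.NumberTheory.GelbartRogawski1991.UnitaryDualPair
open Literature.NumberTheory.GelbartRogawski1991.GRConstruction
open Literature.NumberTheory.K2Lit.SiegelDoubled
open Summit.HodgeConjecture.HodgeConjecture.Cruxes.HLiu418.K2LiuTensorEmbPlaceComponents

variable (L : Type) [Field L] [NumberField L] [IsCMField L]
variable {N M n : ℕ} (e : Fin N × Fin M ≃ Fin n)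
  (dV : Fin N → L) (hdV : ∀ i, IsCMField.complexConj L (dV i) = dV i)
  (dW : Fin M → L) (hdW : ∀ i, IsCMField.complexConj L (dW i) = dW i)
variable {M₂ M' n' : ℕ} (eW : Fin M × Fin M₂ ≃ Fin M') (e' : Fin N × Fin M' ≃ Fin n')
  (dV' : Fin M₂ → L) (hdV' : ∀ k, IsCMField.complexConj L (dV' k) = dV' k)

/-- the entries of the `K_∞`-matrix of `g_∞ = archPart g` are `ringEquiv_mixedSpace (fst (g_{ij}))` (definitional). [cite: BorelJacquet1979, §4.1] -/
theorem coe_archPart_apply (g : HA L e dV hdV dW hdW) (i j : Fin (n + n)) :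
    (((UnitaryGroup.archPart (Fp L) L (IsCMField.complexConj L) (n + n) (hermD L e dV hdV dW hdW) g :
        UnitaryGroup.arch (Fp L) L (IsCMField.complexConj L) (n + n) (hermD L e dV hdV dW hdW)) : GL (Fin (n + n)) (mixedSpace L)) :
          Matrix (Fin (n + n)) (Fin (n + n)) (mixedSpace L)) i j =
      (InfiniteAdeleRing.ringEquiv_mixedSpace L)
        (((((g : HA L e dV hdV dW hdW) : GL (Fin (n + n)) (AdeleRing (𝓞 L) L)) : Matrix (Fin (n + n)) (Fin (n + n)) (AdeleRing (𝓞 L) L)) i j).1) :=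
  rfl

/-- **THE `K_∞`-MATRIX OF `(k ⊗ 1)_∞` IS `reindex epsD (k_∞ ⊗ₖ 1)`** (★ `map_coe_tensorEmb` along `ringEquiv_mixedSpace ∘ fst`).
[cite: Kudla1994, §2 (doubled space, Siegel parabolic)] [cite: BorelJacquet1979, §4.1] -/
theorem coe_archPart_tensorEmb (k : HA L e dV hdV dW hdW) :
    (((UnitaryGroup.archPart (Fp L) L (IsCMField.complexConj L) (n' + n')
        (hermD L e' dV hdV (tensorFrame L dW eW dV') (tensorFrame_real L dW hdW eW dV' hdV'))
        (tensorEmb L e dV hdV dW hdW eW e' dV' hdV' k) :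
          UnitaryGroup.arch (Fp L) L (IsCMField.complexConj L) (n' + n')
            (hermD L e' dV hdV (tensorFrame L dW eW dV') (tensorFrame_real L dW hdW eW dV' hdV'))) :
          GL (Fin (n' + n')) (mixedSpace L)) : Matrix (Fin (n' + n')) (Fin (n' + n')) (mixedSpace L)) =
      Matrix.reindex (epsD e eW e') (epsD e eW e')
        ((((UnitaryGroup.archPart (Fp L) L (IsCMField.complexConj L) (n + n) (hermD L e dV hdV dW hdW) k :
            UnitaryGroup.arch (Fp L) L (IsCMField.complexConj L) (n + n) (hermD L e dV hdV dW hdW)) : GL (Fin (n + n)) (mixedSpace L)) :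
              Matrix (Fin (n + n)) (Fin (n + n)) (mixedSpace L)) ⊗ₖ (1 : Matrix (Fin M₂) (Fin M₂) (mixedSpace L))) := by
  have h := map_coe_tensorEmb L e dV hdV dW hdW eW e' dV' hdV'
    (((InfiniteAdeleRing.ringEquiv_mixedSpace L).toRingHom).comp (UnitaryGroup.adeleFst L)) k
  exact h

/-- **AT A COMPLEX PLACE `w`, THE MATRIX OF `((k ⊗ 1)_∞)_w` IS `reindex epsD ((k_∞)_w ⊗ₖ 1)`** (★ `coe_archAt` + the previous lemma +
★ `kronecker_one_map`). [cite: BorelJacquet1979, §4.1] [cite: Kudla1994, §2 (doubled space, Siegel parabolic)] -/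
theorem coe_archAt_archPart_tensorEmb (k : HA L e dV hdV dW hdW) (w : {w : InfinitePlace L // w.IsComplex}) :
    (((UnitaryGroup.archAt (Fp L) L (IsCMField.complexConj L) (n' + n')
        (hermD L e' dV hdV (tensorFrame L dW eW dV') (tensorFrame_real L dW hdW eW dV' hdV')) w
        (complexConj_smul_infinitePlace L w.1) (IsCMField.complexConj_ne_one L)
        (UnitaryGroup.archPart (Fp L) L (IsCMField.complexConj L) (n' + n')
          (hermD L e' dV hdV (tensorFrame L dW eW dV') (tensorFrame_real L dW hdW eW dV' hdV'))
          (tensorEmb L e dV hdV dW hdW eW e' dV' hdV' k)) :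
          UnitaryGroup.archLocal L (n' + n') (hermD L e' dV hdV (tensorFrame L dW eW dV') (tensorFrame_real L dW hdW eW dV' hdV')) w) :
          GL (Fin (n' + n')) ℂ) : Matrix (Fin (n' + n')) (Fin (n' + n')) ℂ) =
      Matrix.reindex (epsD e eW e') (epsD e eW e')
        ((((UnitaryGroup.archAt (Fp L) L (IsCMField.complexConj L) (n + n) (hermD L e dV hdV dW hdW) w
            (complexConj_smul_infinitePlace L w.1) (IsCMField.complexConj_ne_one L)
            (UnitaryGroup.archPart (Fp L) L (IsCMField.complexConj L) (n + n) (hermD L e dV hdV dW hdW) k) :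
              UnitaryGroup.archLocal L (n + n) (hermD L e dV hdV dW hdW) w) : GL (Fin (n + n)) ℂ) : Matrix (Fin (n + n)) (Fin (n + n)) ℂ) ⊗ₖ
          (1 : Matrix (Fin M₂) (Fin M₂) ℂ)) := by
  rw [UnitaryGroup.coe_archAt, UnitaryGroup.coe_archAt]
  change (((UnitaryGroup.archPart (Fp L) L (IsCMField.complexConj L) (n' + n')
        (hermD L e' dV hdV (tensorFrame L dW eW dV') (tensorFrame_real L dW hdW eW dV' hdV'))
        (tensorEmb L e dV hdV dW hdW eW e' dV' hdV' k) :
          UnitaryGroup.arch (Fp L) L (IsCMField.complexConj L) (n' + n')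
            (hermD L e' dV hdV (tensorFrame L dW eW dV') (tensorFrame_real L dW hdW eW dV' hdV'))) :
          GL (Fin (n' + n')) (mixedSpace L)) : Matrix (Fin (n' + n')) (Fin (n' + n')) (mixedSpace L)).map (evalC L w) =
      Matrix.reindex (epsD e eW e') (epsD e eW e')
        (((((UnitaryGroup.archPart (Fp L) L (IsCMField.complexConj L) (n + n) (hermD L e dV hdV dW hdW) k :
            UnitaryGroup.arch (Fp L) L (IsCMField.complexConj L) (n + n) (hermD L e dV hdV dW hdW)) : GL (Fin (n + n)) (mixedSpace L)) :
              Matrix (Fin (n + n)) (Fin (n + n)) (mixedSpace L)).map (evalC L w)) ⊗ₖ (1 : Matrix (Fin M₂) (Fin M₂) ℂ))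
  rw [coe_archPart_tensorEmb, Matrix.reindex_apply, Matrix.reindex_apply, ← Matrix.submatrix_map, kronecker_one_map]

end Summit.HodgeConjecture.HodgeConjecture.Cruxes.HLiu418.K2LiuArchTensorEmbArchComponent

end
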